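import Summits.Ventures.GridStability.Bench.WSCC9Deg4ASosgramDinstData6
import Summits.Ventures.GridStability.Bench.WSCC9Deg4ASosgramDinstData7
import Literature.Computation.Certificates.PosSemidefIntList
import HarnessLib
-- import re-plumb (gridfusion-sos-3 g3, 2026-08-27): this file = emitter v0.9 output (kit j267541) with ONLY its `import` block
-- rewritten to the shards it actually references (the emitted linear chain Data k → Data k−1 costs one hub olean-build wait per file).
-- PORT cert/sos-5/emit_lean.py@a0fbeb927efb3b7b / source WSCC9-deg4-A-sosgram-Dinst.json sha256: 9d83c75afa575de83560d25f77d549e4d3648c3bbe936f375082822466631ae6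
-- estimated kernel time of this file's `decide`s: 146 s (emitter calibration 2026-08-26; RULING 8 budget 200 s per file)

/-!
# Ventures/GridStability — Bench/WSCC9Deg4ASosgramDinstPsd2.lean: ℤ-LIST PSD ROW BLOCKS 2 of 5 of certificate file `WSCC9-deg4-A-sosgram-Dinst` (system WSCC9, V degree 4, toolchain A)

Kernel row checks `PSD.rowCheckZ` (Literature/Computation/Certificates/PosSemidefIntList.lean; lever
L5 data refinement + L2 integer data) of the integer rounded Gram certificates `(…_zA, …_zd, …_zBT)`
of certificate `WSCC9-deg4-A-sosgram-Dinst` (data in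
`Summits.Ventures.GridStability.Bench.WSCC9Deg4ASosgramDinstData20`): theorems
`deg4_A_sosgram_Dinst_Vdot_neg_free_zr2`, `deg4_A_sosgram_Dinst_Vdot_neg_free_zr3` — each `∀ i : Fin
s, b·c ≤ i < b·(c+1) → rowCheckZ … i = true` by ONE `decide +kernel`. They are assembled into
`PSD.IsGramCertZ` / `GramSOS.QuadNonneg` facts in the proof files
`WSCC9Deg4ASosgramDinstPart<k>.lean` / `WSCC9Deg4ASosgramDinst.lean`. Split by the emitter so that
each file's kernel time stays inside the RULING 8 budget (estimated 146 s here). CERTIFIED column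
raw checks; no inequality is concluded in this file. «algebraic inequalities certified; ROA
inclusion pending Lyapunov/ lemma».
-/

namespace Summit.Ventures.GridStability.Bench.WSCC9

open Literature.Computation.Certificates Literature.Computation.Certificates.SOS
open Literature.Computation.Certificates.SOS.Poly

/-! ### ℤ-list PSD row blocks (`PSD.rowCheckZ`, `decide +kernel`) — data in `Summits.Ventures.GridStability.Bench.WSCC9Deg4ASosgramDinstData` -/

set_option maxHeartbeats 0 in
/-- ℤ-LIST PSD ROW BLOCK 3/6 of `deg4_A_sosgram_Dinst_Vdot_neg_free` (rows 40–59 of 103): the integer residual `A − Bᵀ·diag zd·B` is diagonally dominant on these rows (`PSD.rowCheckZ`, one `decide`). [folklore] -/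
theorem deg4_A_sosgram_Dinst_Vdot_neg_free_zr2 : ∀ i : Fin 103, 20 * 2 ≤ i.val → i.val < 20 * (2 + 1) →
    PSD.rowCheckZ 103 103 deg4_A_sosgram_Dinst_Vdot_neg_free_zA deg4_A_sosgram_Dinst_Vdot_neg_free_zd deg4_A_sosgram_Dinst_Vdot_neg_free_zBT i.val = true := by
  decide +kernel

set_option maxHeartbeats 0 in
/-- ℤ-LIST PSD ROW BLOCK 4/6 of `deg4_A_sosgram_Dinst_Vdot_neg_free` (rows 60–79 of 103): the integer residual `A − Bᵀ·diag zd·B` is diagonally dominant on these rows (`PSD.rowCheckZ`, one `decide`). [folklore] -/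
theorem deg4_A_sosgram_Dinst_Vdot_neg_free_zr3 : ∀ i : Fin 103, 20 * 3 ≤ i.val → i.val < 20 * (3 + 1) →
    PSD.rowCheckZ 103 103 deg4_A_sosgram_Dinst_Vdot_neg_free_zA deg4_A_sosgram_Dinst_Vdot_neg_free_zd deg4_A_sosgram_Dinst_Vdot_neg_free_zBT i.val = true := by
  decide +kernel

end Summit.Ventures.GridStability.Bench.WSCC9
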